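/-
Copyright (c) 2026 the pub-hodgecm-mathlib formalisation cell (harness21).  Prover seat hodgecm-mathlib-LH7-p06 (g3), req620 Track A «(D-RAM) FOUR-FRAME» squad
((β₂) road (R-36), the K6 road; K6 desk LH4-p16 (g3) WORD #14 (4) «LH7-p06: K6-(r) UNIFORM REFINEMENT TRANSFER» — ARCHITECTURE A's bridge from the per-cell digit systems `Rd_i` to
the common fine system `Rd⋆`), 2026-09-05.
-/
import Summits.HodgeConjecture.HodgeConjecture.Theorems.F0P3cDyRamOneChartDigitTotals   -- ★ p864509 (this seat): `card_filter_ball_eq` (the value of `ρ`); brings ★ LH4-p09 `card_eq_card_of_repr`, ★ Lit `v_varpi_pow`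
import HarnessLib

/-!
# Crux `H413`, line LH4 «(D-RAM) FOUR-FRAME» — (β₂) road, K6-(r): «UNIFORM REFINEMENT TRANSFER» — refining a σ-fixed integral digit system from modulus `|ϖ|^n` to `|ϖ|^{n⋆}`
# multiplies every class count and every class sum by ONE number `ρ = #(Rd⋆ ∩ ball |ϖ|^n)`

Cell `hodgecm-mathlib` (D-0151), FLOOR 0, crux item H413 = `stmt-HodgeConjecture-24833`, route of record `HCCMUnconditional`; squad F0∕P3c∕LH4 (hand LH7-p06); lane
`--supports stmt-HodgeConjecture-24833 --as helper` (count-neutral).  THEOREMS ONLY (no `def`, no instance, no notation, no `sorry`, default heartbeats); ONE field `E`, `|ϖ| = exp(−1)`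
(no datum beyond `hϖ`; the closed form of `ρ` is ★ `card_filter_ball_eq`).
THE TWO DIGIT SYSTEMS (★ p863833's `Rd` letters with the σ-fixed-integral clause, as in ★ `…OneChartDigitTotals`): a COARSE `Rd` — complete and irredundant for `{V ∣ σV = V, |V| ≤ 1}`
modulo `|ϖ|^n` — and a FINE `Rd⋆` modulo `|ϖ|^{n⋆}`, `n ≤ n⋆`; CLASS DATA modulo `|ϖ|^n`: a predicate `P` and a function `F` on the σ-fixed integers, constant on `|ϖ|^n`-classes
(`hP`, `hF`).
WHY (K6 desk WORD #14, ARCHITECTURE A for ‹CORE-3›∕‹CORE-ODD›).  LH4-p18's per-cell law F1b (★ p864627) is read on the cell's OWN digit system `Rd_i` modulo `r_i = |ϖ|^{b+2(N−1−i)}`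
(the admissible precision is cell-dependent), while the window spine (★ p864238 ∕ LH4-p16's HEAD₃), the density (★ p864447) and the label sum (★ p864489) live on ONE fine system `Rd⋆`
modulo `r⋆ = |ϖ|^{b+2(N−1)}`.  THIS FILE is the bridge: every coarse class of `Rd` is refined by EXACTLY `ρ := #(Rd⋆.filter (|·| ≤ |ϖ|^n))` fine digits (the fibre over `V₀` and the
translate `V₀ + (Rd⋆ ∩ ball)` are two complete irredundant systems of the same class, ★ `card_eq_card_of_repr` — §1), so for class data `(P, F)` the fine count is `ρ×` the coarse
count and the fine sum is `ρ×` the coarse sum (coarse-class map `π : Rd⋆ → Rd`, fibrewise — §2); `ρ ≥ 1` and, for an even coarse exponent `n = 2t`, `ρ = q^{⌈(n⋆ − n)∕2⌉}` (★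
`card_filter_ball_eq`) — §3.  So F1b's identity at `(Rd_i, r_i)` times `ρ_i` IS the identity at `Rd⋆`: the cell law is resolution-covariant.
* §1 `exists_coarse_of_fine`, `coarse_unique`, `card_fibre_eq`; §2 HEADS `card_filter_fine_eq_mul`, `sum_filter_fine_eq_mul`; §3 `fibreCount_pos` (the closed form `ρ = q^{⌈(n⋆−2t)∕2⌉}` for an
  even coarse exponent `n = 2t` IS ★ `…OneChartDigitTotals.card_filter_ball_eq` — cite it, no restatement here).
WHAT IS NOT CLAIMED: any per-cell law, any census statement; which `(n, n⋆)` the row uses is the assembler's (WORD #14: `n_i = b + 2(N−1−i)`, `n⋆ = b + 2(N−1)`).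
HONEST LABEL.  Count-neutral digit bookkeeping; nothing printed is asserted; K6-(r)'s consumers (‹CORE-3›∕‹CORE-ODD›), β₂ stay HYPOTHESES elsewhere; `HC_CM` is proved only modulo the
7 printed citations (2 remaining named inputs: hLiu418 = `stmt-HodgeConjecture-24832`, h413 = `stmt-HodgeConjecture-24833`) until rung 0 closes.
## References
* [Serre1979] J.-P. Serre, *Local Fields*, GTM 67 (1979): Ch. II §4 Prop. 5 (p. 32: representatives ∕ digit expansions), Ch. IV §2 Prop. 6.
* [Kottwitz1986BaseChangeUnits] R. E. Kottwitz, *Base change for unit elements of Hecke algebras*, Compositio Math. 60 (1986): §1 pp. 240–241 (cell-by-cell lattice bookkeeping).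
-/

set_option autoImplicit false

namespace Summit.HodgeConjecture.HodgeConjecture.Cruxes.H413.F0P3cDyRamDigitRefinementTransfer

open WithZero Finset
open scoped Valued
open Summit.HodgeConjecture.HodgeConjecture.Cruxes.H413.F0P3cDyRamDiagonalFixedClassSystems (card_eq_card_of_repr)

variable {E : Type} [Field E] [Valued E ℤᵐ⁰] {σ : E →+* E} {ϖ : E}

/-! ## §1 The coarse class of a fine digit, and the size of a fibre -/

/-- **EVERY FINE DIGIT HAS A COARSE CLASS**: `V⋆ ∈ Rd⋆` (σ-fixed integral) lies within `|ϖ|^n` of some `V₀ ∈ Rd`. [cite: Serre1979, Ch. II §4 Prop. 5 (p. 32)] -/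
theorem exists_coarse_of_fine (Rd Rdf : Finset E) {n : ℕ}
    (hRd2 : ∀ V : E, σ V = V → Valued.v V ≤ 1 → ∃ V₀ ∈ Rd, Valued.v (V - V₀) ≤ Valued.v ϖ ^ n)
    (hRdf1 : ∀ V ∈ Rdf, σ V = V ∧ Valued.v V ≤ 1) (V : E) (hV : V ∈ Rdf) :
    ∃ V₀ ∈ Rd, Valued.v (V - V₀) ≤ Valued.v ϖ ^ n :=
  hRd2 V (hRdf1 V hV).1 (hRdf1 V hV).2

/-- **THE COARSE CLASS IS UNIQUE**: two members of the irredundant `Rd` within `|ϖ|^n` of one `V` coincide. [cite: Serre1979, Ch. IV §2 Prop. 6] -/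
theorem coarse_unique (Rd : Finset E) {n : ℕ} (hRd3 : ∀ V ∈ Rd, ∀ V' ∈ Rd, Valued.v (V - V') ≤ Valued.v ϖ ^ n → V = V')
    {V V₀ V₁ : E} (h₀ : V₀ ∈ Rd) (h₁ : V₁ ∈ Rd) (hV₀ : Valued.v (V - V₀) ≤ Valued.v ϖ ^ n) (hV₁ : Valued.v (V - V₁) ≤ Valued.v ϖ ^ n) : V₀ = V₁ := by
  refine hRd3 V₀ h₀ V₁ h₁ ?_
  rw [show V₀ - V₁ = (V - V₁) - (V - V₀) by ring]
  exact (Valuation.map_sub _ _ _).trans (max_le hV₁ hV₀)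

/-- **EVERY COARSE CLASS IS REFINED BY EXACTLY `ρ` FINE DIGITS**: for `V₀ ∈ Rd`, `#(Rd⋆.filter (|· − V₀| ≤ |ϖ|^n)) = #(Rd⋆.filter (|·| ≤ |ϖ|^n)) =: ρ` (`n ≤ n⋆`): the fibre and the
translate `V₀ + (Rd⋆ ∩ ball)` are both complete irredundant systems of `{W ∣ σW = W ∧ |W − V₀| ≤ |ϖ|^n}` modulo `|ϖ|^{n⋆}` (★ `card_eq_card_of_repr`).
[cite: Serre1979, Ch. IV §2 Prop. 6] [cite: Kottwitz1986BaseChangeUnits, §1 pp. 240–241] -/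
theorem card_fibre_eq [DecidableEq E] (hϖ : Valued.v ϖ = exp (-1 : ℤ)) (Rd Rdf : Finset E) {n nf : ℕ} (hle : n ≤ nf)
    (hRd1 : ∀ V ∈ Rd, σ V = V ∧ Valued.v V ≤ 1)
    (hRdf1 : ∀ V ∈ Rdf, σ V = V ∧ Valued.v V ≤ 1)
    (hRdf2 : ∀ V : E, σ V = V → Valued.v V ≤ 1 → ∃ V₀ ∈ Rdf, Valued.v (V - V₀) ≤ Valued.v ϖ ^ nf)
    (hRdf3 : ∀ V ∈ Rdf, ∀ V' ∈ Rdf, Valued.v (V - V') ≤ Valued.v ϖ ^ nf → V = V')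
    (V₀ : E) (hV₀ : V₀ ∈ Rd) :
    (Rdf.filter fun V => Valued.v (V - V₀) ≤ Valued.v ϖ ^ n).card = (Rdf.filter fun V => Valued.v V ≤ Valued.v ϖ ^ n).card := by
  have hϖ1 : Valued.v ϖ ≤ 1 := by rw [hϖ, ← exp_zero, exp_le_exp]; norm_num
  have hfn : Valued.v ϖ ^ nf ≤ Valued.v ϖ ^ n := pow_le_pow_right_of_le_one' hϖ1 hle
  have hn1 : Valued.v ϖ ^ n ≤ 1 := pow_le_one₀ zero_le hϖ1
  obtain ⟨hσV₀, hV₀1⟩ := hRd1 V₀ hV₀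
  -- the translate of the small ball is a second system of the class of `V₀`
  have hinj : Set.InjOn (fun V : E => V + V₀) ↑(Rdf.filter fun V => Valued.v V ≤ Valued.v ϖ ^ n) := fun a _ b _ h => add_right_cancel h
  rw [← card_image_of_injOn hinj]
  refine card_eq_card_of_repr (A := {W : E | σ W = W ∧ Valued.v (W - V₀) ≤ Valued.v ϖ ^ n}) (r := Valued.v ϖ ^ nf) _ _
    (fun g hg => ⟨(hRdf1 g (mem_filter.1 hg).1).1, (mem_filter.1 hg).2⟩) (fun f hf => ?_)
    (fun g hg g' hg' h => hRdf3 g (mem_filter.1 hg).1 g' (mem_filter.1 hg').1 h)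
    (fun g hg => ?_) (fun f hf => ?_) (fun g hg g' hg' h => ?_)
  · -- covering by the fibre
    obtain ⟨hσf, hf⟩ := hf
    have hf1 : Valued.v f ≤ 1 := by
      rw [show f = (f - V₀) + V₀ by ring]; exact (Valuation.map_add _ _ _).trans (max_le (hf.trans hn1) hV₀1)
    obtain ⟨g, hgR, hfg⟩ := hRdf2 f hσf hf1
    refine ⟨g, mem_filter.2 ⟨hgR, ?_⟩, hfg⟩
    rw [show g - V₀ = (f - V₀) - (f - g) by ring]
    exact (Valuation.map_sub _ _ _).trans (max_le hf (hfg.trans hfn))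
  · -- members of the translate
    obtain ⟨a, ha, rfl⟩ := mem_image.1 hg
    obtain ⟨haR, hav⟩ := mem_filter.1 ha
    exact ⟨by rw [map_add, (hRdf1 a haR).1, hσV₀], by rwa [add_sub_cancel_right]⟩
  · -- covering by the translate
    obtain ⟨hσf, hf⟩ := hf
    have hσ' : σ (f - V₀) = f - V₀ := by rw [map_sub, hσf, hσV₀]
    obtain ⟨g, hgR, hfg⟩ := hRdf2 (f - V₀) hσ' (hf.trans hn1)
    refine ⟨g + V₀, mem_image.2 ⟨g, mem_filter.2 ⟨hgR, ?_⟩, rfl⟩, by rwa [show f - (g + V₀) = (f - V₀) - g by ring]⟩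
    rw [show g = (f - V₀) - ((f - V₀) - g) by ring]
    exact (Valuation.map_sub _ _ _).trans (max_le hf (hfg.trans hfn))
  · -- separation of the translate
    obtain ⟨a, ha, rfl⟩ := mem_image.1 hg
    obtain ⟨a', ha', rfl⟩ := mem_image.1 hg'
    rw [show a + V₀ - (a' + V₀) = a - a' by ring] at h
    rw [hRdf3 a (mem_filter.1 ha).1 a' (mem_filter.1 ha').1 h]

/-! ## §2 HEADS — fine class counts and class sums are `ρ ×` the coarse ones -/

/-- **HEAD (count) — «UNIFORM REFINEMENT TRANSFER»**: for class data `P` constant on `|ϖ|^n`-classes of the σ-fixed integers,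
`#(Rd⋆.filter P) = ρ · #(Rd.filter P)`, `ρ = #(Rd⋆.filter (|·| ≤ |ϖ|^n))`. [cite: Serre1979, Ch. IV §2 Prop. 6] [cite: Kottwitz1986BaseChangeUnits, §1 pp. 240–241] -/
theorem card_filter_fine_eq_mul [DecidableEq E] (hϖ : Valued.v ϖ = exp (-1 : ℤ)) (Rd Rdf : Finset E) {n nf : ℕ} (hle : n ≤ nf)
    (hRd1 : ∀ V ∈ Rd, σ V = V ∧ Valued.v V ≤ 1)
    (hRd2 : ∀ V : E, σ V = V → Valued.v V ≤ 1 → ∃ V₀ ∈ Rd, Valued.v (V - V₀) ≤ Valued.v ϖ ^ n)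
    (hRd3 : ∀ V ∈ Rd, ∀ V' ∈ Rd, Valued.v (V - V') ≤ Valued.v ϖ ^ n → V = V')
    (hRdf1 : ∀ V ∈ Rdf, σ V = V ∧ Valued.v V ≤ 1)
    (hRdf2 : ∀ V : E, σ V = V → Valued.v V ≤ 1 → ∃ V₀ ∈ Rdf, Valued.v (V - V₀) ≤ Valued.v ϖ ^ nf)
    (hRdf3 : ∀ V ∈ Rdf, ∀ V' ∈ Rdf, Valued.v (V - V') ≤ Valued.v ϖ ^ nf → V = V')
    (P : E → Prop) [DecidablePred P]
    (hP : ∀ V V' : E, σ V = V → Valued.v V ≤ 1 → σ V' = V' → Valued.v V' ≤ 1 → Valued.v (V - V') ≤ Valued.v ϖ ^ n → (P V ↔ P V')) :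
    (Rdf.filter P).card = (Rdf.filter fun V => Valued.v V ≤ Valued.v ϖ ^ n).card * (Rd.filter P).card := by
  -- the coarse-class map
  choose! π hπR hπnear using fun V (hV : V ∈ Rdf) => exists_coarse_of_fine (σ := σ) Rd Rdf hRd2 hRdf1 V hV
  have hfib : ∀ V ∈ Rdf, ∀ V₀ ∈ Rd, (π V = V₀ ↔ Valued.v (V - V₀) ≤ Valued.v ϖ ^ n) := fun V hV V₀ hV₀ =>
    ⟨fun h => h ▸ hπnear V hV, fun h => coarse_unique Rd hRd3 (hπR V hV) hV₀ (hπnear V hV) h⟩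
  have hPπ : ∀ V ∈ Rdf, (P V ↔ P (π V)) := fun V hV =>
    hP V (π V) (hRdf1 V hV).1 (hRdf1 V hV).2 (hRd1 _ (hπR V hV)).1 (hRd1 _ (hπR V hV)).2 (hπnear V hV)
  have hmaps : ∀ V ∈ Rdf.filter P, π V ∈ Rd.filter P := fun V hV =>
    mem_filter.2 ⟨hπR V (mem_filter.1 hV).1, (hPπ V (mem_filter.1 hV).1).1 (mem_filter.1 hV).2⟩
  rw [card_eq_sum_card_fiberwise hmaps, sum_const_nat (m := (Rdf.filter fun V => Valued.v V ≤ Valued.v ϖ ^ n).card) fun V₀ hV₀ => ?_]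
  · exact mul_comm _ _
  -- each fibre is the whole class of `V₀`, of size `ρ`
  obtain ⟨hV₀R, hPV₀⟩ := mem_filter.1 hV₀
  have hset : (Rdf.filter P).filter (fun V => π V = V₀) = Rdf.filter (fun V => Valued.v (V - V₀) ≤ Valued.v ϖ ^ n) := by
    ext V
    simp only [mem_filter]
    constructor
    · rintro ⟨⟨hV, -⟩, hπ⟩
      exact ⟨hV, (hfib V hV V₀ hV₀R).1 hπ⟩
    · rintro ⟨hV, hn⟩
      have hπ : π V = V₀ := (hfib V hV V₀ hV₀R).2 hn
      exact ⟨⟨hV, by rw [hPπ V hV, hπ]; exact hPV₀⟩, hπ⟩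
  rw [hset, card_fibre_eq hϖ Rd Rdf hle hRd1 hRdf1 hRdf2 hRdf3 V₀ hV₀R]

/-- **HEAD (sum) — «UNIFORM REFINEMENT TRANSFER»**: for class data `(P, F)` constant on `|ϖ|^n`-classes of the σ-fixed integers,
`Σ_{V ∈ Rd⋆.filter P} F V = ρ · Σ_{V ∈ Rd.filter P} F V`, `ρ = #(Rd⋆.filter (|·| ≤ |ϖ|^n))`. [cite: Serre1979, Ch. IV §2 Prop. 6] [cite: Kottwitz1986BaseChangeUnits, §1 pp. 240–241] -/
theorem sum_filter_fine_eq_mul [DecidableEq E] (hϖ : Valued.v ϖ = exp (-1 : ℤ)) (Rd Rdf : Finset E) {n nf : ℕ} (hle : n ≤ nf)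
    (hRd1 : ∀ V ∈ Rd, σ V = V ∧ Valued.v V ≤ 1)
    (hRd2 : ∀ V : E, σ V = V → Valued.v V ≤ 1 → ∃ V₀ ∈ Rd, Valued.v (V - V₀) ≤ Valued.v ϖ ^ n)
    (hRd3 : ∀ V ∈ Rd, ∀ V' ∈ Rd, Valued.v (V - V') ≤ Valued.v ϖ ^ n → V = V')
    (hRdf1 : ∀ V ∈ Rdf, σ V = V ∧ Valued.v V ≤ 1)
    (hRdf2 : ∀ V : E, σ V = V → Valued.v V ≤ 1 → ∃ V₀ ∈ Rdf, Valued.v (V - V₀) ≤ Valued.v ϖ ^ nf)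
    (hRdf3 : ∀ V ∈ Rdf, ∀ V' ∈ Rdf, Valued.v (V - V') ≤ Valued.v ϖ ^ nf → V = V')
    (P : E → Prop) [DecidablePred P]
    (hP : ∀ V V' : E, σ V = V → Valued.v V ≤ 1 → σ V' = V' → Valued.v V' ≤ 1 → Valued.v (V - V') ≤ Valued.v ϖ ^ n → (P V ↔ P V'))
    (F : E → ℤ)
    (hF : ∀ V V' : E, σ V = V → Valued.v V ≤ 1 → σ V' = V' → Valued.v V' ≤ 1 → Valued.v (V - V') ≤ Valued.v ϖ ^ n → F V = F V') :
    ∑ V ∈ Rdf.filter P, F V = ((Rdf.filter fun V => Valued.v V ≤ Valued.v ϖ ^ n).card : ℤ) * ∑ V ∈ Rd.filter P, F V := by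
  choose! π hπR hπnear using fun V (hV : V ∈ Rdf) => exists_coarse_of_fine (σ := σ) Rd Rdf hRd2 hRdf1 V hV
  have hfib : ∀ V ∈ Rdf, ∀ V₀ ∈ Rd, (π V = V₀ ↔ Valued.v (V - V₀) ≤ Valued.v ϖ ^ n) := fun V hV V₀ hV₀ =>
    ⟨fun h => h ▸ hπnear V hV, fun h => coarse_unique Rd hRd3 (hπR V hV) hV₀ (hπnear V hV) h⟩
  have hPπ : ∀ V ∈ Rdf, (P V ↔ P (π V)) := fun V hV =>
    hP V (π V) (hRdf1 V hV).1 (hRdf1 V hV).2 (hRd1 _ (hπR V hV)).1 (hRd1 _ (hπR V hV)).2 (hπnear V hV)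
  have hFπ : ∀ V ∈ Rdf, F V = F (π V) := fun V hV =>
    hF V (π V) (hRdf1 V hV).1 (hRdf1 V hV).2 (hRd1 _ (hπR V hV)).1 (hRd1 _ (hπR V hV)).2 (hπnear V hV)
  have hmaps : ∀ V ∈ Rdf.filter P, π V ∈ Rd.filter P := fun V hV =>
    mem_filter.2 ⟨hπR V (mem_filter.1 hV).1, (hPπ V (mem_filter.1 hV).1).1 (mem_filter.1 hV).2⟩
  rw [← sum_fiberwise_of_maps_to hmaps, mul_sum]
  refine sum_congr rfl fun V₀ hV₀ => ?_
  obtain ⟨hV₀R, hPV₀⟩ := mem_filter.1 hV₀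
  have hset : (Rdf.filter P).filter (fun V => π V = V₀) = Rdf.filter (fun V => Valued.v (V - V₀) ≤ Valued.v ϖ ^ n) := by
    ext V
    simp only [mem_filter]
    constructor
    · rintro ⟨⟨hV, -⟩, hπ⟩
      exact ⟨hV, (hfib V hV V₀ hV₀R).1 hπ⟩
    · rintro ⟨hV, hn⟩
      have hπ : π V = V₀ := (hfib V hV V₀ hV₀R).2 hn
      exact ⟨⟨hV, by rw [hPπ V hV, hπ]; exact hPV₀⟩, hπ⟩
  have hconst : ∀ V ∈ (Rdf.filter P).filter (fun V => π V = V₀), F V = F V₀ := fun V hV => by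
    obtain ⟨hV, hπ⟩ := mem_filter.1 hV
    rw [hFπ V (mem_filter.1 hV).1, hπ]
  rw [sum_congr rfl hconst, sum_const, nsmul_eq_mul, hset, card_fibre_eq hϖ Rd Rdf hle hRd1 hRdf1 hRdf2 hRdf3 V₀ hV₀R]

/-! ## §3 The refinement factor `ρ` -/

/-- **`ρ ≥ 1`**: the fine system has a member in the ball `|V| ≤ |ϖ|^n` (the fine representative of `0`); for EVEN `n = 2t` the exact value `ρ = q^{⌈(n⋆ − n)∕2⌉}` is ★
`…OneChartDigitTotals.card_filter_ball_eq` (odd `n`: the σ-fixed ball of exponent `n` equals that of `n + 1`, even fixed valuations). [cite: Serre1979, Ch. II §4 Prop. 5 (p. 32)] -/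
theorem fibreCount_pos (hϖ : Valued.v ϖ = exp (-1 : ℤ)) (Rdf : Finset E) {n nf : ℕ} (hle : n ≤ nf)
    (hRdf2 : ∀ V : E, σ V = V → Valued.v V ≤ 1 → ∃ V₀ ∈ Rdf, Valued.v (V - V₀) ≤ Valued.v ϖ ^ nf) :
    0 < (Rdf.filter fun V => Valued.v V ≤ Valued.v ϖ ^ n).card := by
  have hϖ1 : Valued.v ϖ ≤ 1 := by rw [hϖ, ← exp_zero, exp_le_exp]; norm_num
  obtain ⟨g, hgR, hg⟩ := hRdf2 0 (map_zero σ) (by rw [map_zero]; exact zero_le)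
  refine card_pos.2 ⟨g, mem_filter.2 ⟨hgR, ?_⟩⟩
  rw [zero_sub, Valuation.map_neg] at hg
  exact hg.trans (pow_le_pow_right_of_le_one' hϖ1 hle)

end Summit.HodgeConjecture.HodgeConjecture.Cruxes.H413.F0P3cDyRamDigitRefinementTransfer
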